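import Summits.BirchSwinnertonDyer.BirchSwinnertonDyer.Theorems.GenusKolyvaginAtTwoPowDvdShaCardAtTwoRTLocalEigenDuality
import Summits.BirchSwinnertonDyer.BirchSwinnertonDyer.Theorems.GenusKolyvaginAtTwoPowDvdShaCardAtTwoRTLocalConjInvariance
import Summits.BirchSwinnertonDyer.BirchSwinnertonDyer.Theorems.GenusKolyvaginAtTwoPowDvdShaCardAtTwoRTUnramifiedParametrization
import Summits.BirchSwinnertonDyer.BirchSwinnertonDyer.Theorems.GenusKolyvaginAtTwoPowDvdShaCardAtTwoRTRegularFrameAtTwo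
import HarnessLib

/-!
# Route `GenusKolyvaginAtTwo`, crux L_T `PowDvdShaCardAtTwoRT` (stmt-BirchSwinnertonDyer-23242), LINE 18 stub KS, the DROPS, input `hrec` —
# THE LOCAL EIGEN-DUALITY LAW AT A DEEP INERT KOLYVAGIN PLACE OF THE HEEGNER FIELD, ASSEMBLED (no displayed local structure left):
# `addOrderOf inv_λ(loc z ∪ₑ loc x) = 2^(α + β − (M+1))` for same-sign `τ`-eigenclasses, `z` Selmer at `λ`

Seat `bsd-line-gk2-p3` g23 (PROVER seat 3/3, cell `bsd-f1-sign2`), `--supports stmt-BirchSwinnertonDyer-23242` (helper; closes nothing).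
THEOREMS ONLY (no definition, no named fact, no `sorry`).  BSD is NOT proved by any of this; neither is the crux nor any stub.

WHY.  This is the local order law behind Kolyvagin's two-term identity (Math. Ann. 291 (1991) Thm. 2.1; input `hrec` of gk2-p2's
`PlusDescent.weakSwapOracle_of_twoPrimeReciprocity`) at each of its two surviving places, now with every local hypothesis of
`…RTLocalEigenDuality` DISCHARGED on the route's frame: `σ_* = conjActPlace` preserves `inv_λ(· ∪ₑ ·)` (`…RTLocalConjInvariance`),
the Kummer condition is parametrised `τ̃_*`-equivariantly by `E[2^M](K̄)` (`…RTUnramifiedParametrization`), and `E[2^M](K̄)` is free of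
rank one over `ℤ/2^M[τ̃_*]` on `Δ < 0` (`…RTRegularFrameAtTwo`).
* **`addOrderOf_invWeilPairing_localization_eq_of_same_sign`** — `K` imaginary quadratic with `τ ≠ 1`, `τ² = 1`; `E/ℚ` globally minimal,
  `Δ < 0`; `ℓ` a Zhang–Kolyvagin prime at `2` with `1 ≤ M ≤ M(ℓ)` and `FrobEqFrobInfty W K (2^M) ℓ`; `λ ∋ ℓ`, `τ • λ = λ`; a Weil datum `e`
  on `E[2^M](K̄)` equivariant for the adapted lift (`hte`, supplied for every lift by `JET.GlobalDuality.exists_weilPairing_liftEquivariant`);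
  a family `inv` injective at `λ` and `IsConjCompatible τ` (THE canonical one is: `canonical_isPerfect`, `isConjCompatible_canonical`).  For
  `z, x ∈ H¹(K, E[2^M])` with `τ_* z = εz`, `τ_* x = εx` (SAME `ε = ±1`), `loc_λ z` Selmer (Kummer) at `λ` with «`2^j loc_λ z = 0 ⟺ α ≤ j`»
  and «`2^j loc_λ x` Kummer `⟺ β ≤ j`»:  **`addOrderOf (inv_λ(loc_λ z ∪ₑ loc_λ x)) = 2^(α + β − (M + 1))`**, and the flipped form.
* `invWeilPairing_localization_eq_zero_of_opposite_signs` — opposite signs pair to `0`.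
In the swap `ℓ₀ ↦ ℓ′` of the DROPS: at `λ′` take `z = c_M(nℓ₀)` (Kummer there, `α = M − d_S(ℓ′)`), `x = c_M(nℓ′)` (`β = M − d_{S∖ℓ₀}(ℓ′)` by
Q2); at `λ₀` take `z = c_M(nℓ′)`, `x = c_M(nℓ₀)`; both pairs have the same sign `−w(E)(−1)^r` (`sign_conjAct_kolyvaginClass_two`), so both
terms have orders `2^(α+β−M−1)` and `…RTLocalEigenDuality.exponent_eq_of_add_eq_zero` turns reciprocity into `d′ + d″ = d₀ + d₀′`.

References: [Kolyvagin1991MathAnn] Thm. 2.1; [McCallumLMS1991] §4 Prop. 4.4, §5 Lemma 5.3 and (13); [GrossLMS1991] §3 (3.2), §4;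
[Jetchev2008] §3.2 (2), §5 Thm. 5.1; [MilneADT2006] I Cor. 2.3, Cor. 3.4.
-/

set_option autoImplicit false

noncomputable section

open scoped Classical
open Function Field NumberField IsDedekindDomain WeierstrassCurve
open Literature.NumberTheory.EllipticCurves Literature.NumberTheory.GaloisRepresentations
open Literature.NumberTheory.GaloisCohomology
open Literature.NumberTheory.Automorphic
open Summit.BirchSwinnertonDyer.Rank1Residual.X11b.Relaxation
open Summit.BirchSwinnertonDyer.Rank1Residual.JET.GlobalDuality

-- the Theorems namespace of this sub repeats the summit name by design (D-0017 nested layout)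
set_option linter.dupNamespace false

namespace Summit.BirchSwinnertonDyer.BirchSwinnertonDyer.Theorems.GenusExact.PlusDescent

variable (W : WeierstrassCurve ℚ) (K : Type) [Field K] [NumberField K] [W.IsElliptic] [W.IsGloballyMinimal]

/-- **THE LOCAL EIGEN-DUALITY LAW AT A DEEP INERT KOLYVAGIN PLACE (assembled).**  See the module docstring for the setting.  For
same-sign `τ`-eigenclasses `z, x ∈ H¹(K, E[2^M])` with `loc_λ z` in the Kummer condition, «`2^j loc_λ z = 0 ⟺ α ≤ j`» and
«`2^j loc_λ x` Kummer `⟺ β ≤ j`»: `addOrderOf (inv_λ(loc_λ z ∪ₑ loc_λ x)) = 2^(α + β − (M + 1))` — one bit lost.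
[cite: Kolyvagin1991MathAnn, Thm. 2.1] [cite: McCallumLMS1991, §5 Lemma 5.3 and (13)] [cite: GrossLMS1991, §3 (3.2)] -/
theorem addOrderOf_invWeilPairing_localization_eq_of_same_sign (hK : IsImaginaryQuadratic K) (hΔ : W.Δ < 0)
    {M ℓ : ℕ} (hM : 1 ≤ M)
    (hℓ : Zhang2014.IsKolyvaginPrime (W.conductorNorm ℤ) W K 2 ℓ) (hk : M ≤ Zhang2014.kolyvaginIndex W 2 ℓ)
    (hF : FrobEqFrobInfty W K (2 ^ M) ℓ) (w : HeightOneSpectrum (𝓞 K)) (hw : (ℓ : 𝓞 K) ∈ w.asIdeal)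
    {τ : K ≃ₐ[ℚ] K} (hτ1 : τ ≠ 1) (hττ : τ * τ = 1) (hfix : τ • w = w)
    (e : (W.baseChange K).geomTorsion ((2 ^ M : ℕ) : ℤ) → (W.baseChange K).geomTorsion ((2 ^ M : ℕ) : ℤ) → AlgebraicClosure K)
    (hμ : ∀ S T, e S T ^ (2 ^ M) = 1)
    (hadd₁ : ∀ S₁ S₂ T, e (S₁ + S₂) T = e S₁ T * e S₂ T)
    (hadd₂ : ∀ S T₁ T₂, e S (T₁ + T₂) = e S T₁ * e S T₂)
    (hgal : ∀ (γ : absoluteGaloisGroup K) (S T : (W.baseChange K).geomTorsion ((2 ^ M : ℕ) : ℤ)), γ • e S T = e (γ • S) (γ • T))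
    (halt : ∀ T, e T T = 1) (hnondeg : ∀ T, (∀ S, e S T = 1) → T = 0)
    (hte : ∀ S T, e ((isLiftOfAut_liftAutPlace τ hfix).torsionMap W ((2 ^ M : ℕ) : ℤ) S)
      ((isLiftOfAut_liftAutPlace τ hfix).torsionMap W ((2 ^ M : ℕ) : ℤ) T) = liftAutPlace τ hfix (e S T))
    (inv : LocalInvariants K (2 ^ M)) (hinj : Injective (inv (Sum.inr w))) (hinvc : inv.IsConjCompatible τ)
    {z x : galoisCohomology ((W.baseChange K).torsionGaloisModule ((2 ^ M : ℕ) : ℤ)) 1} {ε : ℤ} (hε : ε = 1 ∨ ε = -1)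
    (hz : conjAct W τ ((2 ^ M : ℕ) : ℤ) z = ε • z) (hx : conjAct W τ ((2 ^ M : ℕ) : ℤ) x = ε • x)
    (hzS : galoisCohomology.localization ((W.baseChange K).torsionGaloisModule ((2 ^ M : ℕ) : ℤ)) (Sum.inr w : Place K) 1 z ∈
      (W.baseChange K).kummerSelmerStructure ((2 ^ M : ℕ) : ℤ) (Sum.inr w))
    {α β : ℕ}
    (hα : ∀ j : ℕ, (2 ^ j) • galoisCohomology.localization ((W.baseChange K).torsionGaloisModule ((2 ^ M : ℕ) : ℤ))
      (Sum.inr w : Place K) 1 z = 0 ↔ α ≤ j)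
    (hβ : ∀ j : ℕ, (2 ^ j) • galoisCohomology.localization ((W.baseChange K).torsionGaloisModule ((2 ^ M : ℕ) : ℤ))
      (Sum.inr w : Place K) 1 x ∈ (W.baseChange K).kummerSelmerStructure ((2 ^ M : ℕ) : ℤ) (Sum.inr w) ↔ β ≤ j) :
    addOrderOf (invWeilPairing (W.baseChange K) (2 ^ M) e hμ hadd₁ hadd₂ hgal inv (Sum.inr w)
        (galoisCohomology.localization ((W.baseChange K).torsionGaloisModule ((2 ^ M : ℕ) : ℤ)) (Sum.inr w : Place K) 1 z)
        (galoisCohomology.localization ((W.baseChange K).torsionGaloisModule ((2 ^ M : ℕ) : ℤ)) (Sum.inr w : Place K) 1 x)) =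
      2 ^ (α + β - (M + 1)) := by
  haveI : Fact (Nat.Prime 2) := ⟨Nat.prime_two⟩
  have hM0 : M ≠ 0 := by omega
  set loc := galoisCohomology.localization ((W.baseChange K).torsionGaloisModule ((2 ^ M : ℕ) : ℤ)) (Sum.inr w : Place K) 1
    with hloc
  set σ := conjActPlace W τ ((2 ^ M : ℕ) : ℤ) hfix with hσdef
  set t := (isLiftOfAut_liftAutPlace τ hfix).torsionMap W ((2 ^ M : ℕ) : ℤ) with htdef
  -- good reduction and `2 ∉ λ`
  obtain ⟨hgood, hpw⟩ := hasGoodReductionAt_of_zhangKolyvaginPrime W K hℓ w hw 1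
  have hpw' : ((2 : ℕ) : 𝓞 K) ∉ w.asIdeal := by rwa [pow_one, Int.cast_natCast] at hpw
  -- the `τ`-structure: `σ` involutive and preserving the pairing
  have hσ : ∀ X, σ (σ X) = X := fun X ↦ conjActPlace_conjActPlace_self W τ (2 ^ M) hττ hfix X
  have hσb := invWeilPairing_conjActPlace_self W τ (2 ^ M) e hμ hadd₁ hadd₂ hgal hfix hte inv hinvc
  -- the unramified parametrisation
  obtain ⟨unr, hunr0, hunrL, hLunr, hunr⟩ :=
    exists_unramified_parametrization_kummer W K hK hℓ hk w hw hpw' hgood τ hfix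
  -- the regular frame
  obtain ⟨Q₀, htor, hspan, hfree, ht⟩ := exists_regular_frame_liftAutPlace W K hK hΔ hM hℓ hk hF w hw hτ1 hfix
  -- `loc z = unr Q` with `t Q = ε Q` and `addOrderOf Q = 2^α`
  obtain ⟨Q, hQ⟩ := hLunr _ hzS
  have hσz : σ (loc z) = ε • loc z := conjActPlace_localization_of_eigen W τ (2 ^ M) hfix hε hz
  have hσx : σ (loc x) = ε • loc x := conjActPlace_localization_of_eigen W τ (2 ^ M) hfix hε hx
  have htQ : t Q = ε • Q := by
    apply hunr0
    rw [hunr, hQ, hσz, map_zsmul, hQ]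
  have hαQ : addOrderOf Q = 2 ^ α := by
    rw [← addOrderOf_unr_eq (W.baseChange K) M w unr hunr0 Q, hQ]
    exact addOrderOf_eq_two_pow_of_forall_iff hα
  have hQX : (t Q = Q ∧ σ (loc x) = loc x) ∨ (t Q = -Q ∧ σ (loc x) = -loc x) := by
    rcases hε with rfl | rfl
    · left; rw [one_zsmul] at htQ hσx; exact ⟨htQ, hσx⟩
    · right; rw [neg_one_zsmul] at htQ hσx; exact ⟨htQ, hσx⟩
  rw [← hQ]
  exact addOrderOf_invWeilPairing_unr_eq_of_same_sign (W.baseChange K) M e hμ hadd₁ hadd₂ hgal halt hnondeg w inv hinj t ht σ hσ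
    hσb unr hunr hunrL hLunr Q₀ hspan hfree htor hM0 hQX hαQ hβ

end Summit.BirchSwinnertonDyer.BirchSwinnertonDyer.Theorems.GenusExact.PlusDescent

end
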